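import Literature.MathematicalPhysics.QuantumFieldTheory.Balaban1983to89.HiggsGaugeInvariance

/-!
# `Balaban1983to89.B1Eq110GaugeOrbit` — T. Bałaban, *(Higgs)₂,₃ quantum fields in a finite volume. I. A lower bound*,
Commun. Math. Phys. **85** (1982) 603–626 [Balaban1982Higgs1], p. 605, (1.9)–(1.10): the GAUGE ORBITS of the lattice Higgs model —
gauge functions pinned at one site, injectivity of `∂^η` and of `∂^{η*}∂^η` on them, **the lattice Poisson problem
`∂^{η*}∂^ηλ = ∂^{η*}A`** and the transverse part `A^⊥` of a vector field — the machinery of the gauge fixing (1.9) → (1.10), PROVED on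
the carrier `…Balaban1983to89.HiggsLattice`

statement-level skeleton of published theorems with citation tags; proofs where landed; nothing here is a claim about the Yang–Mills mass gap

PDF held: `paper:balaban1982-cmp85-higgs23-i` (journal page = PDF page + 602), p. 605 [PDF 3].

WHAT IS REPRODUCED.  Third of the five lit-balaban seat-p28 (gen 8) files on SKELETON row **B1.Eq1.9-1.10** (*"Z'^ε (1.9), Z^ε (1.10)
(gauge-fixed; equal up to the gauge-orbit volume factor, BFS [5])"*, owners r01/r14); p. 605, verbatim: *"In Sect. 5.1 the authors
[of [5] = Brydges–Fröhlich–Seiler, Ann. Phys. 121 (1979), NOT HELD (acq-09341) — nothing is quoted from it] have shown how to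
introduce the gauge fixing terms in the integral (1.9), using the properties of (1.8) under the gauge transformations."*  The gauge
group of (1.7) is the NON-COMPACT abelian group of gauge functions `λ : T → R`; modulo constants (which act trivially) it is
parametrised by the functions pinned at a base point:
* §1 pinned gauge functions (`Pinned`, `ext0`), `∂^η` / `∂^{η*}` / `∂^{η*}∂^η` as linear maps (`gradL`, `divL`, `grad0L`, `lap0L`), the
  energy identity `Σ_x η^dλ(x)(∂^{η*}∂^ηλ)(x) = ‖∂^ηλ‖²_η` (`energy_identity`), `∂^ηλ = 0 ⇒ λ = 0` and `∂^{η*}∂^ηλ = 0 ⇒ λ = 0` for pinned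
  `λ` (`grad0L_injective`, `lap0L_injective`; from `HiggsGaugeInvariance.eq_default_of_grad_eq_zero`);
* §2 **the Poisson problem**: `∂^{η*}∂^η` is a linear bijection from the pinned gauge functions onto the mean-zero site functions
  (`lap0K_bijective`: injective both ways between spaces of equal finite dimension), so every `∂^{η*}A` (mean zero) is `∂^{η*}∂^ηλ_A`
  for a unique pinned `λ_A = poisson A`, LINEAR in `A` (`poisson`, `lap_poisson`); the transverse part `A^⊥ = A − ∂^ηλ_A` with
  `∂^{η*}A^⊥ = 0` (`perp`, `div_perp`) and `A − ∂^η(ext0 ν) = A^⊥ − ∂^η(ext0 (ν − λ_A))` (`sub_grad_eq_perp_sub`);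
* §3 continuity of `ν ↦ ∂^η(ext0 ν)`, of `A ↦ A^⊥` and of the mass / gauge-fixing terms (`continuous_grad0`, `continuous_perp`,
  `continuous_massTerm`, `continuous_divTerm`).
The orbit integrals are `…B1Eq110OrbitGaussians`; the identity (1.9) ↔ (1.10) is `…B1Eq110GaugeFixing`.  Nothing of [Balaban1982Higgs1]
beyond the quoted sentence is asserted; no `Prop`-valued fact is introduced.  Unit `lit-balaban-p28` (Phase-2 proof seat p28, gen 8;
DEPGRAPH node `EXT:BFS1979` at its B1 use), HOME `run/shared/lean/pub/lit-balaban/`.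
-/

open scoped BigOperators ENNReal
open _root_.MeasureTheory

namespace Literature.MathematicalPhysics.QuantumFieldTheory.Balaban1983to89.B1Eq110GaugeOrbit

open HiggsLattice HiggsCovariancePos HiggsHodgeIdentity HiggsGaugeInvariance

variable {P : Params} {k N : ℕ}

noncomputable section

/-! ## §1 Pinned gauge functions, `∂^η` and `∂^{η*}∂^η` as linear maps -/

variable (P k) in
/-- The sites of `T^{(k)}` other than the base point `default` (label `0`): gauge functions vanishing at the base point
parametrise each gauge orbit exactly once (the gauge group `λ : T → R` of (1.7) acts with the constants as stabiliser-free kernel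
of `∂^η`). [cite: Balaban1982Higgs1, (1.9) p.605] -/
abbrev Pinned : Type := {x : Site P k // x ≠ default}

/-- Extension by zero of a pinned gauge function to all of `T^{(k)}` (a linear map). [cite: Balaban1982Higgs1, (1.9) p.605] -/
def ext0 : (Pinned P k → ℝ) →ₗ[ℝ] (Site P k → ℝ) where
  toFun ν x := if h : x = default then 0 else ν ⟨x, h⟩
  map_add' ν ν' := by
    funext x
    by_cases h : x = default <;> simp [h]
  map_smul' t ν := by
    funext x
    by_cases h : x = default <;> simp [h]

/-- `ext0 ν` vanishes at the base point. [cite: Balaban1982Higgs1, (1.9) p.605] -/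
@[simp] theorem ext0_default (ν : Pinned P k → ℝ) : ext0 ν default = 0 := by
  simp [ext0]

/-- `ext0 ν` agrees with `ν` off the base point. [cite: Balaban1982Higgs1, (1.9) p.605] -/
@[simp] theorem ext0_val (ν : Pinned P k → ℝ) (y : Pinned P k) : ext0 ν y.1 = ν y := by
  simp [ext0, y.2]

/-- The gradient `∂^η` (1.4) as a linear map on gauge functions. [cite: Balaban1982Higgs1, (1.4) p.604] -/
def gradL : (Site P k → ℝ) →ₗ[ℝ] VecField P k where
  toFun := grad
  map_add' := grad_add
  map_smul' := grad_smul

/-- The divergence `∂^{η*}` as a linear map. [cite: Balaban1982Higgs1, (1.5) p.604] -/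
def divL : VecField P k →ₗ[ℝ] (Site P k → ℝ) where
  toFun := div
  map_add' := div_add
  map_smul' := div_smul

/-- `∂^η ∘ ext0`: the gradient of a pinned gauge function. [cite: Balaban1982Higgs1, (1.4) p.604] -/
def grad0L : (Pinned P k → ℝ) →ₗ[ℝ] VecField P k := gradL ∘ₗ ext0

/-- `∂^{η*}∂^η ∘ ext0`: the lattice Laplacian of a pinned gauge function. [cite: Balaban1982Higgs1, (1.5) p.604] -/
def lap0L : (Pinned P k → ℝ) →ₗ[ℝ] (Site P k → ℝ) := divL ∘ₗ grad0L

/-- unfolding `grad0L`. [cite: Balaban1982Higgs1, (1.4) p.604] -/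
@[simp] theorem grad0L_apply (ν : Pinned P k → ℝ) : grad0L ν = grad (ext0 ν) := rfl

/-- unfolding `lap0L`. [cite: Balaban1982Higgs1, (1.5) p.604] -/
@[simp] theorem lap0L_apply (ν : Pinned P k → ℝ) : lap0L ν = div (grad (ext0 ν)) := rfl

/-- **Energy identity** `Σ_x η^d λ(x)(∂^{η*}∂^ηλ)(x) = ‖∂^ηλ‖²_η`. [cite: Balaban1982Higgs1, (1.5) p.604] -/
theorem energy_identity (lam : Site P k → ℝ) :
    ∑ x : Site P k, P.mesh k ^ P.d * (lam x * div (grad lam) x) = bondSq (grad lam) := by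
  rw [← sum_grad_mul]
  unfold bondSq
  exact Finset.sum_congr rfl fun b _ => by ring

/-- `‖B‖²_η = 0 ⇒ B = 0`. [cite: Balaban1982Higgs1, (1.5) p.604] -/
theorem eq_zero_of_bondSq_eq_zero {B : VecField P k} (h : bondSq B = 0) : B = 0 := by
  have hterm := (Finset.sum_eq_zero_iff_of_nonneg fun b _ =>
    mul_nonneg (pow_nonneg (P.mesh_pos k).le _) (sq_nonneg (B b))).1 h
  funext b
  have hb := hterm b (Finset.mem_univ b)
  rcases mul_eq_zero.1 hb with h1 | h2
  · exact absurd h1 (pow_ne_zero _ (P.mesh_pos k).ne')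
  · exact pow_eq_zero_iff (n := 2) (by norm_num) |>.1 h2

/-- A pinned gauge function with vanishing gradient vanishes (connectedness of the torus). [cite: Balaban1982Higgs1, (1.9) p.605] -/
theorem eq_zero_of_grad_ext0_eq_zero {ν : Pinned P k → ℝ} (h : grad (ext0 ν) = 0) : ν = 0 := by
  funext y
  have := eq_default_of_grad_eq_zero h y.1
  rw [ext0_val, ext0_default] at this
  exact this

/-- `∂^η` is injective on pinned gauge functions. [cite: Balaban1982Higgs1, (1.9) p.605] -/
theorem grad0L_injective : Function.Injective (grad0L : (Pinned P k → ℝ) →ₗ[ℝ] VecField P k) := by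
  rw [← LinearMap.ker_eq_bot, LinearMap.ker_eq_bot']
  intro ν hν
  exact eq_zero_of_grad_ext0_eq_zero hν

/-- `∂^{η*}∂^η` is injective on pinned gauge functions. [cite: Balaban1982Higgs1, (1.9) p.605] -/
theorem lap0L_injective : Function.Injective (lap0L : (Pinned P k → ℝ) →ₗ[ℝ] (Site P k → ℝ)) := by
  rw [← LinearMap.ker_eq_bot, LinearMap.ker_eq_bot']
  intro ν hν
  have hE := energy_identity (ext0 ν)
  rw [lap0L_apply] at hν
  rw [hν] at hE
  simp only [Pi.zero_apply, mul_zero, Finset.sum_const_zero] at hE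
  exact eq_zero_of_grad_ext0_eq_zero (eq_zero_of_bondSq_eq_zero hE.symm)

/-! ## §2 The lattice Poisson problem and the transverse part -/

/-- The total-sum functional `f ↦ Σ_x f(x)` on the site functions of the torus (1.2) (`η^{−d}⟨1,f⟩` for the scalar product (1.5);
its kernel = the mean-zero site functions, the range of `∂^{η*}`). [cite: Balaban1982Higgs1, (1.5) p.604] -/
def sumL : (Site P k → ℝ) →ₗ[ℝ] ℝ where
  toFun f := ∑ x : Site P k, f x
  map_add' f g := by simp [Finset.sum_add_distrib]
  map_smul' t f := by simp [Finset.mul_sum]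

/-- Divergences have total sum zero. [cite: Balaban1982Higgs1, (1.5) p.604] -/
theorem sumL_div (A : VecField P k) : sumL (div A) = 0 := sum_div A

/-- `∂^{η*}∂^η` on pinned gauge functions, with values in the mean-zero site functions. [cite: Balaban1982Higgs1, (1.5) p.604] -/
def lap0K : (Pinned P k → ℝ) →ₗ[ℝ] LinearMap.ker (sumL : (Site P k → ℝ) →ₗ[ℝ] ℝ) :=
  LinearMap.codRestrict _ lap0L fun ν => by
    rw [LinearMap.mem_ker, lap0L_apply]
    exact sumL_div _

/-- restriction of a mean-zero site function to the non-base sites. [folklore] -/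
private def resK : LinearMap.ker (sumL : (Site P k → ℝ) →ₗ[ℝ] ℝ) →ₗ[ℝ] (Pinned P k → ℝ) :=
  (LinearMap.funLeft ℝ ℝ (Subtype.val : Pinned P k → Site P k)) ∘ₗ (LinearMap.ker sumL).subtype

/-- a mean-zero function vanishing off the base point vanishes. [folklore] -/
private theorem resK_injective : Function.Injective (resK : _ →ₗ[ℝ] (Pinned P k → ℝ)) := by
  rw [← LinearMap.ker_eq_bot, LinearMap.ker_eq_bot']
  intro f hf
  have hval : ∀ y : Pinned P k, (f : Site P k → ℝ) y.1 = 0 := fun y => by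
    have := congr_fun hf y
    simpa [resK] using this
  have hsum : ∑ x : Site P k, (f : Site P k → ℝ) x = 0 := f.2
  have hdef : (f : Site P k → ℝ) default = 0 := by
    rw [Finset.sum_eq_single (default : Site P k) (fun x _ hx => hval ⟨x, hx⟩) (fun h => absurd (Finset.mem_univ _) h)]
      at hsum
    exact hsum
  apply Subtype.ext
  funext x
  by_cases hx : x = default
  · rw [hx]; exact hdef
  · exact hval ⟨x, hx⟩

/-- **`∂^{η*}∂^η : {pinned gauge functions} → {mean-zero site functions}` is a linear bijection** (injective both ways between
spaces of equal dimension). [cite: Balaban1982Higgs1, (1.9) p.605] -/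
theorem lap0K_bijective : Function.Bijective (lap0K : (Pinned P k → ℝ) →ₗ[ℝ] _) := by
  have hinj : Function.Injective (lap0K : (Pinned P k → ℝ) →ₗ[ℝ] _) := fun ν ν' h =>
    lap0L_injective (by simpa [lap0K] using congrArg Subtype.val h)
  have h1 := LinearMap.finrank_le_finrank_of_injective hinj
  have h2 := LinearMap.finrank_le_finrank_of_injective (resK_injective (P := P) (k := k))
  exact ⟨hinj, (LinearMap.injective_iff_surjective_of_finrank_eq_finrank (le_antisymm h1 h2)).1 hinj⟩

/-- the Laplacian on pinned gauge functions as a linear equivalence onto the mean-zero functions. [cite: Balaban1982Higgs1, (1.9) p.605] -/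
def lapEquiv : (Pinned P k → ℝ) ≃ₗ[ℝ] LinearMap.ker (sumL : (Site P k → ℝ) →ₗ[ℝ] ℝ) :=
  LinearEquiv.ofBijective lap0K lap0K_bijective

/-- **Solution of the lattice Poisson problem** `∂^{η*}∂^η λ_A = ∂^{η*}A`, `λ_A` pinned — LINEAR in `A`.
[cite: Balaban1982Higgs1, (1.9) p.605] -/
def poisson : VecField P k →ₗ[ℝ] (Pinned P k → ℝ) :=
  lapEquiv.symm.toLinearMap ∘ₗ LinearMap.codRestrict _ divL fun A => by
    rw [LinearMap.mem_ker]; exact sumL_div A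

/-- `∂^{η*}∂^η λ_A = ∂^{η*}A`. [cite: Balaban1982Higgs1, (1.9) p.605] -/
theorem lap_poisson (A : VecField P k) : div (grad (ext0 (poisson A))) = div A := by
  have h : lapEquiv (poisson A) = ⟨div A, by rw [LinearMap.mem_ker]; exact sumL_div A⟩ := by
    simp only [poisson, LinearMap.coe_comp, Function.comp_apply, LinearEquiv.coe_toLinearMap,
      LinearEquiv.apply_symm_apply]
    rfl
  have h' := congrArg Subtype.val h
  simpa [lapEquiv, lap0K] using h'

/-- The TRANSVERSE (divergence-free) part `A^⊥ = A − ∂^ηλ_A` of a vector field. [cite: Balaban1982Higgs1, (1.9) p.605] -/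
def perp (A : VecField P k) : VecField P k := A - grad (ext0 (poisson A))

/-- `∂^{η*}A^⊥ = 0`. [cite: Balaban1982Higgs1, (1.9) p.605] -/
theorem div_perp (A : VecField P k) : div (perp A) = 0 := by
  unfold perp; rw [div_sub, lap_poisson, sub_self]

/-- moving along the orbit: `A − ∂^η ext0 ν = A^⊥ − ∂^η ext0 (ν − λ_A)`. [cite: Balaban1982Higgs1, (1.9) p.605] -/
theorem sub_grad_eq_perp_sub (A : VecField P k) (ν : Pinned P k → ℝ) :
    A - grad (ext0 ν) = perp A - grad (ext0 (ν - poisson A)) := by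
  unfold perp
  rw [map_sub, grad_sub]
  abel

/-- continuity of `poisson` (a linear map of finite-dimensional spaces). [folklore] -/
private theorem continuous_poisson : Continuous (poisson : VecField P k → (Pinned P k → ℝ)) :=
  LinearMap.continuous_of_finiteDimensional _

/-- continuity of `ν ↦ ∂^η(ext0 ν)` (the difference derivative (1.4) is linear on a finite-dimensional space). [cite: Balaban1982Higgs1, (1.4) p.604] -/
theorem continuous_grad0 : Continuous (fun ν : Pinned P k → ℝ => grad (ext0 ν)) :=
  LinearMap.continuous_of_finiteDimensional (grad0L : (Pinned P k → ℝ) →ₗ[ℝ] VecField P k)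

/-- continuity of the transverse part `A ↦ A^⊥` of the gauge fixing (1.9) → (1.10). [cite: Balaban1982Higgs1, (1.10) p.605] -/
theorem continuous_perp : Continuous (perp : VecField P k → VecField P k) :=
  continuous_id.sub (continuous_grad0.comp continuous_poisson)

/-! ## §3 Continuity bookkeeping -/

/-- continuity of `‖·‖²_η` on bond fields. [folklore] -/
private theorem continuous_bondSq : Continuous (bondSq : VecField P k → ℝ) :=
  continuous_finsetSum _ fun b _ => ((continuous_apply b).pow 2).const_mul _

/-- continuity of `‖·‖²_η` on site functions. [folklore] -/
private theorem continuous_siteSq : Continuous (siteSq : (Site P k → ℝ) → ℝ) :=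
  continuous_finsetSum _ fun x _ => ((continuous_apply x).pow 2).const_mul _

/-- continuity of the divergence. [folklore] -/
private theorem continuous_div : Continuous (div : VecField P k → Site P k → ℝ) :=
  LinearMap.continuous_of_finiteDimensional (divL : VecField P k →ₗ[ℝ] (Site P k → ℝ))

/-- continuity of the Proca mass term `½μ₀²‖A‖²_η` of (1.8). [cite: Balaban1982Higgs1, (1.8) p.605] -/
theorem continuous_massTerm (mu0sq : ℝ) : Continuous (massTerm mu0sq : VecField P k → ℝ) :=
  (continuous_bondSq.const_mul mu0sq).div_const 2

/-- continuity of the Feynman gauge-fixing term `½‖∂^{η*}A‖²_η` of (1.11). [cite: Balaban1982Higgs1, (1.11) p.605] -/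
theorem continuous_divTerm : Continuous (divTerm : VecField P k → ℝ) :=
  (continuous_siteSq.comp continuous_div).div_const 2

end

end Literature.MathematicalPhysics.QuantumFieldTheory.Balaban1983to89.B1Eq110GaugeOrbit
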